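import Mathlib.Data.Nat.Prime.Int
import Summits.Langlands.Langlands.Theorems.CapacityClassicalityCongruenceToClassicalDefs

/-!
# Integer matrices of prime determinant and the Hecke correspondence at a prime `ℓ`

Helper file for `CongruenceToClassical` (route CapacityClassicality, item stmt-Langlands-10367):
the elementary (Hermite normal form) decomposition of an integer matrix of prime determinant `ℓ`
whose first column is not divisible by `ℓ` as `γ · matU ℓ j` with `γ ∈ SL(2, ℤ)`; the choice of a
representative `γ₀ T^t` of a cusp with `ℓ ∣ d` or `ℓ ∣ b`; and the two matrices
`[[ℓ a, b], [c, d/ℓ]]`, `[[a, b/ℓ], [ℓ c, d]]` through which the term `G ∣ γ₁ ∣ matV ℓ` appears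
in the `T_ℓ`-relation slashed at a suitable `γ`.
-/

set_option linter.dupNamespace false -- project-wide option (lakefile weak.linter.dupNamespace); `Summit.Langlands.Langlands` is the mandated namespace

noncomputable section

open Complex UpperHalfPlane Matrix

open scoped MatrixGroups ModularForm

namespace Summit.Langlands.Langlands.Theorems.CapacityClassicality

/-! ## Hermite decomposition -/

/-- An integer matrix of prime determinant `ℓ` whose first column is not divisible by `ℓ` is of
the form `γ · [[1, j], [0, ℓ]]` with `γ ∈ SL(2, ℤ)` and `0 ≤ j < ℓ`. -/
theorem exists_eq_mul_matU {ℓ : ℕ} (hℓ : ℓ.Prime) (μ : Matrix (Fin 2) (Fin 2) ℤ)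
    (hdet : μ.det = ℓ) (hcol : ¬ ((ℓ : ℤ) ∣ μ 0 0 ∧ (ℓ : ℤ) ∣ μ 1 0)) :
    ∃ (γ : SL(2, ℤ)) (j : ℤ), 0 ≤ j ∧ j < ℓ ∧ μ = (γ : Matrix (Fin 2) (Fin 2) ℤ) * matU ℓ j := by
  -- the first column is coprime
  have hcop : IsCoprime (μ 0 0) (μ 1 0) := by
    rw [Int.isCoprime_iff_gcd_eq_one]
    have hg : (Int.gcd (μ 0 0) (μ 1 0) : ℤ) ∣ (ℓ : ℤ) := by
      rw [← hdet, Matrix.det_fin_two]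
      exact dvd_sub (dvd_mul_of_dvd_left (Int.gcd_dvd_left _ _) _)
        (dvd_mul_of_dvd_right (Int.gcd_dvd_right _ _) _)
    have hg' : Int.gcd (μ 0 0) (μ 1 0) ∣ ℓ := by exact_mod_cast hg
    rcases (Nat.dvd_prime hℓ).mp hg' with h | h
    · exact h
    · exfalso
      apply hcol
      constructor
      · rw [← h]; exact Int.gcd_dvd_left _ _
      · rw [← h]; exact Int.gcd_dvd_right _ _
  obtain ⟨γ, h0, h1⟩ := hcop.exists_SL2_col 0
  -- ν := γ⁻¹ μ is upper triangular with diagonal (1, ℓ)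
  set ν : Matrix (Fin 2) (Fin 2) ℤ := ((γ⁻¹ : SL(2, ℤ)) : Matrix (Fin 2) (Fin 2) ℤ) * μ with hν
  have hγdet : γ 0 0 * γ 1 1 - γ 0 1 * γ 1 0 = 1 := by
    have := γ.2; rwa [Matrix.det_fin_two] at this
  have hν10 : ν 1 0 = 0 := by
    simp only [hν, Matrix.SpecialLinearGroup.coe_inv, Matrix.mul_apply, Fin.sum_univ_two,
      ← h0, ← h1]
    simp [Matrix.adjugate_fin_two]
    ring
  have hν00 : ν 0 0 = 1 := by
    simp only [hν, Matrix.SpecialLinearGroup.coe_inv, Matrix.mul_apply, Fin.sum_univ_two]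
    simp [Matrix.adjugate_fin_two, ← h0, ← h1]
    linear_combination hγdet
  have hνdet : ν.det = ℓ := by
    simp only [hν, Matrix.det_mul, Matrix.SpecialLinearGroup.det_coe, one_mul, hdet]
  have hν11 : ν 1 1 = ℓ := by
    have := hνdet
    rw [Matrix.det_fin_two, hν10, hν00] at this
    simpa using this
  have hμ : μ = (γ : Matrix (Fin 2) (Fin 2) ℤ) * ν := by
    simp only [hν, ← Matrix.mul_assoc]
    rw [← Matrix.SpecialLinearGroup.coe_mul, mul_inv_cancel, Matrix.SpecialLinearGroup.coe_one,
      Matrix.one_mul]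
  -- write ν 0 1 = ℓ * s + j with 0 ≤ j < ℓ
  have hℓ0 : (ℓ : ℤ) ≠ 0 := by exact_mod_cast hℓ.ne_zero
  set s : ℤ := ν 0 1 / ℓ
  set j : ℤ := ν 0 1 % ℓ
  have hj : ν 0 1 = ℓ * s + j := by linarith [Int.emod_add_mul_ediv (ν 0 1) ℓ]
  refine ⟨γ * ModularGroup.T ^ s, j, Int.emod_nonneg _ hℓ0, ?_, ?_⟩
  · have := Int.emod_lt_of_pos (ν 0 1) (show (0 : ℤ) < ℓ by exact_mod_cast hℓ.pos)
    exact this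
  · rw [hμ, Matrix.SpecialLinearGroup.coe_mul, Matrix.mul_assoc]
    congr 1
    ext i k
    fin_cases i <;> fin_cases k <;>
      simp [ModularGroup.coe_T_zpow, matU, Matrix.mul_apply, Fin.sum_univ_two, hν00, hν10, hν11,
        hj]
    ring

/-! ## Choosing a good representative of a cusp -/

/-- For `γ₀ ∈ SL(2, ℤ)` and a prime `ℓ`, some right translate `γ₀ T^t` has its `(1,1)` or its
`(0,1)` entry divisible by `ℓ`. -/
theorem exists_T_zpow_dvd {ℓ : ℕ} (hℓ : ℓ.Prime) (γ₀ : SL(2, ℤ)) :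
    ∃ t : ℤ, (ℓ : ℤ) ∣ (γ₀ * ModularGroup.T ^ t) 1 1 ∨ (ℓ : ℤ) ∣ (γ₀ * ModularGroup.T ^ t) 0 1 := by
  have hprime : Prime (ℓ : ℤ) := Nat.prime_iff_prime_int.mp hℓ
  have hentry : ∀ t : ℤ, (γ₀ * ModularGroup.T ^ t) 1 1 = γ₀ 1 0 * t + γ₀ 1 1 ∧
      (γ₀ * ModularGroup.T ^ t) 0 1 = γ₀ 0 0 * t + γ₀ 0 1 := by
    intro t
    constructor <;>
      simp [Matrix.SpecialLinearGroup.coe_mul, ModularGroup.coe_T_zpow, Matrix.mul_apply,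
        Fin.sum_univ_two]
  by_cases hc : (ℓ : ℤ) ∣ γ₀ 1 0
  · -- then `ℓ ∤ γ₀ 0 0`; solve `γ₀ 0 0 * t + γ₀ 0 1 ≡ 0 (mod ℓ)` by Bezout
    have ha : ¬ (ℓ : ℤ) ∣ γ₀ 0 0 := by
      intro ha
      have hdet := γ₀.2
      rw [Matrix.det_fin_two] at hdet
      have : (ℓ : ℤ) ∣ 1 := by
        rw [← hdet]
        exact dvd_sub (dvd_mul_of_dvd_left ha _) (dvd_mul_of_dvd_right hc _)
      exact hprime.not_dvd_one this
    obtain ⟨u, v, huv⟩ := (Prime.coprime_iff_not_dvd hprime).mpr ha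
    refine ⟨-(γ₀ 0 1 * v), Or.inr ?_⟩
    rw [(hentry _).2]
    refine ⟨γ₀ 0 1 * u, ?_⟩
    linear_combination (-(γ₀ 0 1)) * huv
  · obtain ⟨u, v, huv⟩ := (Prime.coprime_iff_not_dvd hprime).mpr hc
    refine ⟨-(γ₀ 1 1 * v), Or.inl ?_⟩
    rw [(hentry _).1]
    refine ⟨γ₀ 1 1 * u, ?_⟩
    linear_combination (-(γ₀ 1 1)) * huv

/-! ## The two local constructions -/

/-- Case A: if `ℓ ∣ d`, then with `γ = [[ℓ a, b], [c, d / ℓ]] ∈ SL(2, ℤ)` one has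
`matU ℓ 0 · γ = γ₁ · matV ℓ`, while the other products `matU ℓ j · γ` (`0 < j < ℓ`) and
`matV ℓ · γ` have first column not divisible by `ℓ`. -/
theorem exists_caseA {ℓ : ℕ} (hℓ : ℓ.Prime) (γ₁ : SL(2, ℤ)) (hd : (ℓ : ℤ) ∣ γ₁ 1 1) :
    ∃ γ : SL(2, ℤ),
      matU ℓ 0 * (γ : Matrix (Fin 2) (Fin 2) ℤ) = (γ₁ : Matrix (Fin 2) (Fin 2) ℤ) * matV ℓ ∧
      (∀ j : ℤ, 0 < j → j < ℓ →
        ¬ ((ℓ : ℤ) ∣ (matU ℓ j * (γ : Matrix (Fin 2) (Fin 2) ℤ)) 0 0 ∧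
          (ℓ : ℤ) ∣ (matU ℓ j * (γ : Matrix (Fin 2) (Fin 2) ℤ)) 1 0)) ∧
      ¬ ((ℓ : ℤ) ∣ (matV ℓ * (γ : Matrix (Fin 2) (Fin 2) ℤ)) 0 0 ∧
        (ℓ : ℤ) ∣ (matV ℓ * (γ : Matrix (Fin 2) (Fin 2) ℤ)) 1 0) := by
  have hdet := γ₁.2
  rw [Matrix.det_fin_two] at hdet
  have h1 : (ℓ : ℤ) * (γ₁ 1 1 / ℓ) = γ₁ 1 1 := Int.mul_ediv_cancel' hd
  have hc : ¬ (ℓ : ℤ) ∣ γ₁ 1 0 := by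
    intro hc
    have : (ℓ : ℤ) ∣ 1 := by
      rw [← hdet]
      exact dvd_sub (dvd_mul_of_dvd_right hd _) (dvd_mul_of_dvd_right hc _)
    exact (Nat.prime_iff_prime_int.mp hℓ).not_dvd_one this
  let γ : SL(2, ℤ) := ⟨!![ℓ * γ₁ 0 0, γ₁ 0 1; γ₁ 1 0, γ₁ 1 1 / ℓ], by
    rw [Matrix.det_fin_two_of]
    linear_combination hdet + γ₁ 0 0 * h1⟩
  have hγ : (γ : Matrix (Fin 2) (Fin 2) ℤ) = !![ℓ * γ₁ 0 0, γ₁ 0 1; γ₁ 1 0, γ₁ 1 1 / ℓ] := rfl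
  refine ⟨γ, ?_, ?_, ?_⟩
  · rw [hγ]
    ext i k
    fin_cases i <;> fin_cases k <;>
      simp [matU, matV, Matrix.mul_apply, Fin.sum_univ_two, h1, mul_comm]
  · intro j hj0 hjℓ
    rintro ⟨h00, -⟩
    have h00' : (matU ℓ j * (γ : Matrix (Fin 2) (Fin 2) ℤ)) 0 0 = ℓ * γ₁ 0 0 + j * γ₁ 1 0 := by
      rw [hγ]
      simp [matU, Matrix.mul_apply, Fin.sum_univ_two]
    rw [h00'] at h00
    have : (ℓ : ℤ) ∣ j * γ₁ 1 0 := (dvd_add_right (dvd_mul_right _ _)).mp h00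
    rcases (Nat.prime_iff_prime_int.mp hℓ).dvd_or_dvd this with h | h
    · have := Int.le_of_dvd hj0 h
      omega
    · exact hc h
  · rintro ⟨-, h10⟩
    have h10' : (matV ℓ * (γ : Matrix (Fin 2) (Fin 2) ℤ)) 1 0 = γ₁ 1 0 := by
      rw [hγ]
      simp [matV, Matrix.mul_apply, Fin.sum_univ_two]
    rw [h10'] at h10
    exact hc h10

/-- Case B: if `ℓ ∣ b`, then with `γ = [[a, b / ℓ], [ℓ c, d]] ∈ SL(2, ℤ)` one has
`matV ℓ · γ = γ₁ · matV ℓ`, while the products `matU ℓ j · γ` have first column not divisible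
by `ℓ`. -/
theorem exists_caseB {ℓ : ℕ} (hℓ : ℓ.Prime) (γ₁ : SL(2, ℤ)) (hb : (ℓ : ℤ) ∣ γ₁ 0 1) :
    ∃ γ : SL(2, ℤ),
      matV ℓ * (γ : Matrix (Fin 2) (Fin 2) ℤ) = (γ₁ : Matrix (Fin 2) (Fin 2) ℤ) * matV ℓ ∧
      ∀ j : ℤ, ¬ ((ℓ : ℤ) ∣ (matU ℓ j * (γ : Matrix (Fin 2) (Fin 2) ℤ)) 0 0 ∧
        (ℓ : ℤ) ∣ (matU ℓ j * (γ : Matrix (Fin 2) (Fin 2) ℤ)) 1 0) := by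
  have hdet := γ₁.2
  rw [Matrix.det_fin_two] at hdet
  have h1 : (ℓ : ℤ) * (γ₁ 0 1 / ℓ) = γ₁ 0 1 := Int.mul_ediv_cancel' hb
  have ha : ¬ (ℓ : ℤ) ∣ γ₁ 0 0 := by
    intro ha
    have : (ℓ : ℤ) ∣ 1 := by
      rw [← hdet]
      exact dvd_sub (dvd_mul_of_dvd_left ha _) (dvd_mul_of_dvd_left hb _)
    exact (Nat.prime_iff_prime_int.mp hℓ).not_dvd_one this
  let γ : SL(2, ℤ) := ⟨!![γ₁ 0 0, γ₁ 0 1 / ℓ; ℓ * γ₁ 1 0, γ₁ 1 1], by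
    rw [Matrix.det_fin_two_of]
    linear_combination hdet - γ₁ 1 0 * h1⟩
  have hγ : (γ : Matrix (Fin 2) (Fin 2) ℤ) = !![γ₁ 0 0, γ₁ 0 1 / ℓ; ℓ * γ₁ 1 0, γ₁ 1 1] := rfl
  refine ⟨γ, ?_, ?_⟩
  · rw [hγ]
    ext i k
    fin_cases i <;> fin_cases k <;>
      simp [matV, Matrix.mul_apply, Fin.sum_univ_two, h1, mul_comm]
  · intro j
    rintro ⟨h00, -⟩
    have h00' : (matU ℓ j * (γ : Matrix (Fin 2) (Fin 2) ℤ)) 0 0 =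
        γ₁ 0 0 + j * (ℓ * γ₁ 1 0) := by
      rw [hγ]
      simp [matU, Matrix.mul_apply, Fin.sum_univ_two]
    rw [h00'] at h00
    apply ha
    have h2 : (ℓ : ℤ) ∣ j * ((ℓ : ℤ) * γ₁ 1 0) := Dvd.dvd.mul_left (dvd_mul_right _ _) _
    exact (dvd_add_left h2).mp h00

end Summit.Langlands.Langlands.Theorems.CapacityClassicality
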